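import Summits.NavierStokesRegularity.NavierStokesRegularity.Theorems.EfficiencyFloorNearSaturationNearMaximiserSeqCoreLocalStrong
import Summits.NavierStokesRegularity.NavierStokesRegularity.Theorems.EfficiencyFloorNearSaturationNearMaximiserSeqCoreWeakLimit
import HarnessLib

/-!
# Route `EfficiencyFloor`, crux `NearSaturationNearMaximiser` (stmt-NavierStokesRegularity-25482) on the
# `ProductionEfficiencyDecay` ladder (stmt-22866): BY NAME — stmt-25482 from the IDENTIFICATION of the weak-limit gradient

Def-free helper file, thirteenth of the group. Composition of `compact_of_localVorticityProfile` (`…SeqCoreLocalStrong`) with the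
sequential Banach–Alaoglu extraction `exists_weakLimit_memLp_two` (`…SeqCoreWeakLimit`, here for finitely many sequences at once):
along every centred normalised maximising sequence the velocity gradients `∂ⱼ v_n` (bounded in `L²`: `‖Dv‖₂² ≤ Z(v) = 1`) have, along a
subsequence `φ₀`, weak limits `M_j ∈ L²(ℝ³; ℝ³)` — PROVED. What remains of the hypothesis is the IDENTIFICATION:
(P_w⁶) = «given such `φ₀` and weak limits `(M_j)`, there are an ADMISSIBLE `w` and a further subsequence `φ₁` with `∂ⱼ w = M_j` a.e. for
each `j` and `∫_{B(0,R)}‖curl (v_{φ₀(φ₁ k)} − w)‖² → 0` for every `R`» — i.e. the weak-limit gradient field of a centred normalised maximising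
sequence is the gradient of a smooth, square-integrable, divergence-free field (REGULARITY and DECAY of the limit profile) towards whose
vorticity the vorticities converge locally strongly (local Rellich).

* `exists_weakLimit_memLp_two_finset`, `exists_weakLimit_memLp_two_finite` — common subsequence for finitely many bounded sequences;
* `compact_of_gradientIdentification`, `nearSaturationNearMaximiser_of_gradientIdentification` — BY NAME: stmt-25482 ⟸ (P_w⁶).

HONEST FRAMING: (P_w⁶) is NOT proved; stmt-25482, `LerayFloorGap`, `ProductionEfficiencyDecay` (stmt-22866) and Navier–Stokes regularity
stay OPEN; no summit statement is proved. [folklore]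
-/

-- the problem directory repeats the summit name (`NavierStokesRegularity/NavierStokesRegularity`)
set_option linter.dupNamespace false

noncomputable section

namespace Summit.NavierStokesRegularity.NavierStokesRegularity.Theorems

namespace NearSaturationNearMaximiser

namespace SeqCore

open Set MeasureTheory Filter Topology Function
open scoped InnerProductSpace ENNReal NNReal
open Literature.Analysis.FluidPDE

/-! ## §1 A common weakly convergent subsequence for finitely many bounded sequences -/

/-- Finitely many `L²`-bounded sequences of fields have a COMMON subsequence along which each converges weakly in `L²` to an `L²`
function (induction on the finite index set, `exists_weakLimit_memLp_two` at each step). [folklore] -/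
theorem exists_weakLimit_memLp_two_finset {ι : Type*} [DecidableEq ι] {F : Type*} [NormedAddCommGroup F] [InnerProductSpace ℝ F]
    [CompleteSpace F] [SecondCountableTopology F] {f : ι → ℕ → EuclideanSpace ℝ (Fin 3) → F}
    (hf : ∀ i k, MemLp (f i k) 2 volume) {C : ℝ} (hC : ∀ i k, ∫ x, ‖f i k x‖ ^ 2 ≤ C) (s : Finset ι) :
    ∃ G : ι → EuclideanSpace ℝ (Fin 3) → F, (∀ i, MemLp (G i) 2 volume) ∧ ∃ φ : ℕ → ℕ, StrictMono φ ∧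
      ∀ i ∈ s, ∀ ψ : EuclideanSpace ℝ (Fin 3) → F, MemLp ψ 2 volume →
        Tendsto (fun k => ∫ x, ⟪f i (φ k) x, ψ x⟫_ℝ) atTop (𝓝 (∫ x, ⟪G i x, ψ x⟫_ℝ)) := by
  induction s using Finset.induction_on with
  | empty => exact ⟨fun _ _ => 0, fun _ => MemLp.zero', id, strictMono_id, fun i hi => absurd hi (Finset.notMem_empty i)⟩
  | @insert a s ha ih =>
    obtain ⟨G, hG, φ, hφ, hs⟩ := ih
    obtain ⟨Ga, hGa, φ', hφ', ha'⟩ :=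
      exists_weakLimit_memLp_two (f := fun k => f a (φ k)) (fun k => hf a (φ k)) (C := C) (fun k => hC a (φ k))
    refine ⟨Function.update G a Ga, fun i => ?_, φ ∘ φ', hφ.comp hφ', fun i hi ψ hψ => ?_⟩
    · by_cases h : i = a
      · subst h; rw [Function.update_self]; exact hGa
      · rw [Function.update_of_ne h]; exact hG i
    · rcases Finset.mem_insert.1 hi with h | h
      · subst h
        rw [Function.update_self]
        exact ha' ψ hψ
      · have hne : i ≠ a := fun h' => ha (h' ▸ h)
        rw [Function.update_of_ne hne]
        exact (hs i h ψ hψ).comp hφ'.tendsto_atTop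

/-- Finitely many `L²`-bounded sequences of fields have a common weakly convergent subsequence (whole finite index type). [folklore] -/
theorem exists_weakLimit_memLp_two_finite {ι : Type*} [Fintype ι] {F : Type*} [NormedAddCommGroup F] [InnerProductSpace ℝ F]
    [CompleteSpace F] [SecondCountableTopology F] {f : ι → ℕ → EuclideanSpace ℝ (Fin 3) → F}
    (hf : ∀ i k, MemLp (f i k) 2 volume) {C : ℝ} (hC : ∀ i k, ∫ x, ‖f i k x‖ ^ 2 ≤ C) :
    ∃ G : ι → EuclideanSpace ℝ (Fin 3) → F, (∀ i, MemLp (G i) 2 volume) ∧ ∃ φ : ℕ → ℕ, StrictMono φ ∧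
      ∀ i, ∀ ψ : EuclideanSpace ℝ (Fin 3) → F, MemLp ψ 2 volume →
        Tendsto (fun k => ∫ x, ⟪f i (φ k) x, ψ x⟫_ℝ) atTop (𝓝 (∫ x, ⟪G i x, ψ x⟫_ℝ)) := by
  classical
  obtain ⟨G, hG, φ, hφ, h⟩ := exists_weakLimit_memLp_two_finset hf hC (Finset.univ : Finset ι)
  exact ⟨G, hG, φ, hφ, fun i => h i (Finset.mem_univ i)⟩

/-! ## §2 By name: stmt-25482 from the identification of the weak-limit gradient -/

/-- **COMPACTNESS from the identification of the weak-limit gradient.** As `compact_of_localVorticityProfile` (`…SeqCoreLocalStrong`):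
the weak convergence of the velocity gradients along a subsequence is PRODUCED here (sequential Banach–Alaoglu), and the hypothesis only
has to IDENTIFY the weak limits `M_j` with the partial derivatives of an admissible profile `w` (plus local strong convergence of the
vorticities along a further subsequence). [folklore] -/
theorem compact_of_gradientIdentification {c : ℝ} (hc : 0 < c)
    (hadm : ∀ f : EuclideanSpace ℝ (Fin 3) → EuclideanSpace ℝ (Fin 3), (ContDiff ℝ (⊤ : ℕ∞) f ∧
      Literature.Analysis.FluidPDE.VectorCalculus.IsDivFree f ∧ (∫⁻ x, ‖iteratedFDeriv ℝ 0 f x‖ₑ ^ 2 < ⊤) ∧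
      (∫⁻ x, ‖iteratedFDeriv ℝ 1 f x‖ₑ ^ 2 < ⊤) ∧ (∫⁻ x, ‖iteratedFDeriv ℝ 2 f x‖ₑ ^ 2 < ⊤)) → (∫ x,
      ⟪Literature.Analysis.FluidPDE.curl f x, fderiv ℝ f x (Literature.Analysis.FluidPDE.curl f x)⟫_ℝ) ≤ c *
      (∫ x, ‖Literature.Analysis.FluidPDE.curl f x‖ ^ 2) ^ (3 / 4 : ℝ) * (∫ x,
      Literature.Analysis.FluidPDE.frobeniusNormSq (fderiv ℝ (Literature.Analysis.FluidPDE.curl f) x)) ^ (3 / 4 : ℝ))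
    (HWi : ∀ K δ : ℝ, 0 < K → 0 < δ → ∀ v : ℕ → EuclideanSpace ℝ (Fin 3) → EuclideanSpace ℝ (Fin 3),
      (∀ n, (ContDiff ℝ (⊤ : ℕ∞) (v n) ∧
      Literature.Analysis.FluidPDE.VectorCalculus.IsDivFree (v n) ∧ (∫⁻ x, ‖iteratedFDeriv ℝ 0 (v n) x‖ₑ ^ 2 < ⊤) ∧
      (∫⁻ x, ‖iteratedFDeriv ℝ 1 (v n) x‖ₑ ^ 2 < ⊤) ∧ (∫⁻ x, ‖iteratedFDeriv ℝ 2 (v n) x‖ₑ ^ 2 < ⊤))) →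
      (∀ n, (∫ x, ‖Literature.Analysis.FluidPDE.curl (v n) x‖ ^ 2) = 1) →
      (∀ n, (∫ x, Literature.Analysis.FluidPDE.frobeniusNormSq (fderiv ℝ (Literature.Analysis.FluidPDE.curl (v n)) x)) = 1) →
      Tendsto (fun n => ∫ x, ⟪Literature.Analysis.FluidPDE.curl (v n) x, fderiv ℝ (v n) x
        (Literature.Analysis.FluidPDE.curl (v n) x)⟫_ℝ) atTop (𝓝 c) →
      (∀ᶠ n in atTop, δ ≤ ∫ x in Metric.ball (0 : EuclideanSpace ℝ (Fin 3)) K, ‖Literature.Analysis.FluidPDE.curl (v n) x‖ ^ 2) →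
      ∀ (φ₀ : ℕ → ℕ) (M : Fin 3 → EuclideanSpace ℝ (Fin 3) → EuclideanSpace ℝ (Fin 3)), StrictMono φ₀ →
      (∀ j, MemLp (M j) 2 volume) →
      (∀ (j : Fin 3) (ψ : EuclideanSpace ℝ (Fin 3) → EuclideanSpace ℝ (Fin 3)), MemLp ψ 2 volume →
        Tendsto (fun k => ∫ x, ⟪fderiv ℝ (v (φ₀ k)) x (EuclideanSpace.basisFun (Fin 3) ℝ j), ψ x⟫_ℝ) atTop
          (𝓝 (∫ x, ⟪M j x, ψ x⟫_ℝ))) →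
      ∃ w : EuclideanSpace ℝ (Fin 3) → EuclideanSpace ℝ (Fin 3), (ContDiff ℝ (⊤ : ℕ∞) w ∧
      Literature.Analysis.FluidPDE.VectorCalculus.IsDivFree w ∧ (∫⁻ x, ‖iteratedFDeriv ℝ 0 w x‖ₑ ^ 2 < ⊤) ∧
      (∫⁻ x, ‖iteratedFDeriv ℝ 1 w x‖ₑ ^ 2 < ⊤) ∧ (∫⁻ x, ‖iteratedFDeriv ℝ 2 w x‖ₑ ^ 2 < ⊤)) ∧
        (∀ j : Fin 3, (fun x => fderiv ℝ w x (EuclideanSpace.basisFun (Fin 3) ℝ j)) =ᵐ[volume] M j) ∧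
        ∃ φ₁ : ℕ → ℕ, StrictMono φ₁ ∧
        (∀ R : ℝ, 0 < R → Tendsto (fun k => ∫ x in Metric.ball (0 : EuclideanSpace ℝ (Fin 3)) R,
          ‖Literature.Analysis.FluidPDE.curl (v (φ₀ (φ₁ k)) - w) x‖ ^ 2) atTop (𝓝 0))) :
    ∀ v : ℕ → EuclideanSpace ℝ (Fin 3) → EuclideanSpace ℝ (Fin 3),
      (∀ n, (ContDiff ℝ (⊤ : ℕ∞) (v n) ∧
      Literature.Analysis.FluidPDE.VectorCalculus.IsDivFree (v n) ∧ (∫⁻ x, ‖iteratedFDeriv ℝ 0 (v n) x‖ₑ ^ 2 < ⊤) ∧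
      (∫⁻ x, ‖iteratedFDeriv ℝ 1 (v n) x‖ₑ ^ 2 < ⊤) ∧ (∫⁻ x, ‖iteratedFDeriv ℝ 2 (v n) x‖ₑ ^ 2 < ⊤))) →
      (∀ n, (∫ x, ‖Literature.Analysis.FluidPDE.curl (v n) x‖ ^ 2) = 1) →
      (∀ n, (∫ x, Literature.Analysis.FluidPDE.frobeniusNormSq (fderiv ℝ (Literature.Analysis.FluidPDE.curl (v n)) x)) = 1) →
      Tendsto (fun n => ∫ x, ⟪Literature.Analysis.FluidPDE.curl (v n) x, fderiv ℝ (v n) x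
        (Literature.Analysis.FluidPDE.curl (v n) x)⟫_ℝ) atTop (𝓝 c) →
      ∃ w : EuclideanSpace ℝ (Fin 3) → EuclideanSpace ℝ (Fin 3), (ContDiff ℝ (⊤ : ℕ∞) w ∧
      Literature.Analysis.FluidPDE.VectorCalculus.IsDivFree w ∧ (∫⁻ x, ‖iteratedFDeriv ℝ 0 w x‖ₑ ^ 2 < ⊤) ∧
      (∫⁻ x, ‖iteratedFDeriv ℝ 1 w x‖ₑ ^ 2 < ⊤) ∧ (∫⁻ x, ‖iteratedFDeriv ℝ 2 w x‖ₑ ^ 2 < ⊤)) ∧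
        ∃ (a : ℕ → EuclideanSpace ℝ (Fin 3)) (φ : ℕ → ℕ), StrictMono φ ∧
        Tendsto (fun k => ∫ x, ‖Literature.Analysis.FluidPDE.curl ((fun x => v (φ k) (x - a k)) - w) x‖ ^ 2) atTop (𝓝 0) ∧
        Tendsto (fun k => ∫ x, Literature.Analysis.FluidPDE.frobeniusNormSq (fderiv ℝ
          (Literature.Analysis.FluidPDE.curl ((fun x => v (φ k) (x - a k)) - w)) x)) atTop (𝓝 0) := by
  refine compact_of_localVorticityProfile hc hadm fun K δ hK hδ v hAdm hZ1 hP1 hS hcen => ?_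
  -- the gradients are bounded in `L²`: extract weak limits along a common subsequence
  have hf : ∀ (j : Fin 3) (k : ℕ), MemLp (fun x => fderiv ℝ (v k) x (EuclideanSpace.basisFun (Fin 3) ℝ j)) 2 volume := by
    intro j k
    have h := (memLp_two_fderiv_apply (hAdm k).1 (hAdm k).2.2.2.1 (hAdm k).2.2.2.2
      (e := EuclideanSpace.basisFun (Fin 3) ℝ j) (by simp)).2.2
    rwa [show (ENNReal.ofReal ((2 : ℕ) : ℝ)) = 2 by norm_num] at h
  have hC : ∀ (j : Fin 3) (k : ℕ), ∫ x, ‖fderiv ℝ (v k) x (EuclideanSpace.basisFun (Fin 3) ℝ j)‖ ^ 2 ≤ 1 := fun j k =>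
    ((memLp_two_fderiv_apply (hAdm k).1 (hAdm k).2.2.2.1 (hAdm k).2.2.2.2 (e := EuclideanSpace.basisFun (Fin 3) ℝ j)
      (by simp)).2.1.trans (integral_norm_fderiv_sq_le_enstrophy (hAdm k))).trans (hZ1 k).le
  obtain ⟨M, hM, φ₀, hφ₀, hconv⟩ := exists_weakLimit_memLp_two_finite
    (f := fun (j : Fin 3) (k : ℕ) (x : EuclideanSpace ℝ (Fin 3)) => fderiv ℝ (v k) x (EuclideanSpace.basisFun (Fin 3) ℝ j)) hf hC
  -- identification
  obtain ⟨w, hw, hMw, φ₁, hφ₁, hloc⟩ := HWi K δ hK hδ v hAdm hZ1 hP1 hS hcen φ₀ M hφ₀ hM hconv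
  refine ⟨w, hw, φ₀ ∘ φ₁, hφ₀.comp hφ₁, hloc, fun j ψ hψ hψc => ?_⟩
  -- `∫⟪∂ⱼ(v_{φ k} − w), ψ⟫ = ∫⟪∂ⱼ v_{φ k}, ψ⟫ − ∫⟪∂ⱼ w, ψ⟫ → ∫⟪M_j, ψ⟫ − ∫⟪M_j, ψ⟫ = 0`
  have hψm : MemLp ψ 2 volume := hψ.memLp_of_hasCompactSupport hψc
  set e : EuclideanSpace ℝ (Fin 3) := EuclideanSpace.basisFun (Fin 3) ℝ j with he
  have hDc : ∀ n, Continuous (fun x => fderiv ℝ (v n) x e) := fun n =>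
    (((hAdm n).1.of_le (by norm_cast) : ContDiff ℝ 1 (v n)).continuous_fderiv one_ne_zero).clm_apply continuous_const
  have hDwc : Continuous (fun x => fderiv ℝ w x e) :=
    ((hw.1.of_le (by norm_cast) : ContDiff ℝ 1 w).continuous_fderiv one_ne_zero).clm_apply continuous_const
  have Iv : ∀ n, Integrable (fun x => ⟪fderiv ℝ (v n) x e, ψ x⟫_ℝ) := fun n =>
    integrable_inner_of_hasCompactSupport_right (hDc n) hψ hψc
  have Iw : Integrable (fun x => ⟪fderiv ℝ w x e, ψ x⟫_ℝ) := integrable_inner_of_hasCompactSupport_right hDwc hψ hψc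
  have heq : ∀ k, (∫ x, ⟪fderiv ℝ (v (φ₀ (φ₁ k)) - w) x e, ψ x⟫_ℝ) =
      (∫ x, ⟪fderiv ℝ (v (φ₀ (φ₁ k))) x e, ψ x⟫_ℝ) - ∫ x, ⟪fderiv ℝ w x e, ψ x⟫_ℝ := by
    intro k
    rw [← integral_sub (Iv _) Iw]
    refine integral_congr_ae (ae_of_all _ fun x => ?_)
    have hd : fderiv ℝ (v (φ₀ (φ₁ k)) - w) x = fderiv ℝ (v (φ₀ (φ₁ k))) x - fderiv ℝ w x :=
      fderiv_sub (((hAdm _).1.differentiable (by simp)) x) ((hw.1.differentiable (by simp)) x)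
    show ⟪fderiv ℝ (v (φ₀ (φ₁ k)) - w) x e, ψ x⟫_ℝ = ⟪fderiv ℝ (v (φ₀ (φ₁ k))) x e, ψ x⟫_ℝ - ⟪fderiv ℝ w x e, ψ x⟫_ℝ
    rw [hd, sub_apply, inner_sub_left]
  have hw_eq : (∫ x, ⟪fderiv ℝ w x e, ψ x⟫_ℝ) = ∫ x, ⟪M j x, ψ x⟫_ℝ :=
    integral_congr_ae ((hMw j).mono fun x hx => by
      have hx' : fderiv ℝ w x e = M j x := hx
      show ⟪fderiv ℝ w x e, ψ x⟫_ℝ = ⟪M j x, ψ x⟫_ℝ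
      rw [hx'])
  have hlim : Tendsto (fun k => ∫ x, ⟪fderiv ℝ (v (φ₀ (φ₁ k))) x e, ψ x⟫_ℝ) atTop (𝓝 (∫ x, ⟪M j x, ψ x⟫_ℝ)) :=
    (hconv j ψ hψm).comp hφ₁.tendsto_atTop
  have h := hlim.sub_const (∫ x, ⟪fderiv ℝ w x e, ψ x⟫_ℝ)
  have h0 : (∫ x, ⟪M j x, ψ x⟫_ℝ) - (∫ x, ⟪fderiv ℝ w x e, ψ x⟫_ℝ) = 0 := by rw [hw_eq, sub_self]
  rw [h0] at h
  exact h.congr fun k => (heq k).symm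

/-- **`NearSaturationNearMaximiser` (stmt-25482) from the identification of the weak-limit gradient, BY NAME.** Assumed, for the sharp
constant: (P_w⁶) — for every centred admissible sequence with `Z = Pal = 1`, `S → c⋆`, every subsequence `φ₀` along which the velocity
gradients `∂ⱼ v_{φ₀ k}` converge weakly in `L²` to fields `M_j ∈ L²` admits an ADMISSIBLE `w` with `∂ⱼ w = M_j` a.e. (the weak-limit
gradient is the gradient of a smooth, square-integrable, divergence-free profile: REGULARITY and DECAY) and a further subsequence with
`∫_{B(0,R)}‖curl (v_{φ₀(φ₁ k)} − w)‖² → 0` for every `R` (local Rellich). The extraction of `φ₀, M` and everything else of the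
concentration-compactness step are PROVED in the tree. NOT proved: (P_w⁶). [folklore] -/
theorem nearSaturationNearMaximiser_of_gradientIdentification
    (HWi : ∀ c : ℝ, (0 < c ∧ (∀ v : EuclideanSpace ℝ (Fin 3) → EuclideanSpace ℝ (Fin 3), (ContDiff ℝ (⊤ : ℕ∞) v ∧
      Literature.Analysis.FluidPDE.VectorCalculus.IsDivFree v ∧ (∫⁻ x, ‖iteratedFDeriv ℝ 0 v x‖ₑ ^ 2 < ⊤) ∧
      (∫⁻ x, ‖iteratedFDeriv ℝ 1 v x‖ₑ ^ 2 < ⊤) ∧ (∫⁻ x, ‖iteratedFDeriv ℝ 2 v x‖ₑ ^ 2 < ⊤)) → (∫ x,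
      ⟪Literature.Analysis.FluidPDE.curl v x, fderiv ℝ v x (Literature.Analysis.FluidPDE.curl v x)⟫_ℝ) ≤ c *
      (∫ x, ‖Literature.Analysis.FluidPDE.curl v x‖ ^ 2) ^ (3 / 4 : ℝ) * (∫ x,
      Literature.Analysis.FluidPDE.frobeniusNormSq (fderiv ℝ (Literature.Analysis.FluidPDE.curl v) x)) ^ (3 / 4 : ℝ)) ∧ ∀ c' : ℝ, (∀ w : EuclideanSpace ℝ (Fin 3) → EuclideanSpace ℝ (Fin 3), (ContDiff ℝ (⊤ : ℕ∞) w ∧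
      Literature.Analysis.FluidPDE.VectorCalculus.IsDivFree w ∧ (∫⁻ x, ‖iteratedFDeriv ℝ 0 w x‖ₑ ^ 2 < ⊤) ∧
      (∫⁻ x, ‖iteratedFDeriv ℝ 1 w x‖ₑ ^ 2 < ⊤) ∧ (∫⁻ x, ‖iteratedFDeriv ℝ 2 w x‖ₑ ^ 2 < ⊤)) → (∫ x,
      ⟪Literature.Analysis.FluidPDE.curl w x, fderiv ℝ w x (Literature.Analysis.FluidPDE.curl w x)⟫_ℝ) ≤ c' *
      (∫ x, ‖Literature.Analysis.FluidPDE.curl w x‖ ^ 2) ^ (3 / 4 : ℝ) * (∫ x,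
      Literature.Analysis.FluidPDE.frobeniusNormSq (fderiv ℝ (Literature.Analysis.FluidPDE.curl w) x)) ^ (3 / 4 : ℝ)) → c ≤ c') →
      ∀ K δ : ℝ, 0 < K → 0 < δ → ∀ v : ℕ → EuclideanSpace ℝ (Fin 3) → EuclideanSpace ℝ (Fin 3),
      (∀ n, (ContDiff ℝ (⊤ : ℕ∞) (v n) ∧
      Literature.Analysis.FluidPDE.VectorCalculus.IsDivFree (v n) ∧ (∫⁻ x, ‖iteratedFDeriv ℝ 0 (v n) x‖ₑ ^ 2 < ⊤) ∧
      (∫⁻ x, ‖iteratedFDeriv ℝ 1 (v n) x‖ₑ ^ 2 < ⊤) ∧ (∫⁻ x, ‖iteratedFDeriv ℝ 2 (v n) x‖ₑ ^ 2 < ⊤))) →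
      (∀ n, (∫ x, ‖Literature.Analysis.FluidPDE.curl (v n) x‖ ^ 2) = 1) →
      (∀ n, (∫ x, Literature.Analysis.FluidPDE.frobeniusNormSq (fderiv ℝ (Literature.Analysis.FluidPDE.curl (v n)) x)) = 1) →
      Tendsto (fun n => ∫ x, ⟪Literature.Analysis.FluidPDE.curl (v n) x, fderiv ℝ (v n) x
        (Literature.Analysis.FluidPDE.curl (v n) x)⟫_ℝ) atTop (𝓝 c) →
      (∀ᶠ n in atTop, δ ≤ ∫ x in Metric.ball (0 : EuclideanSpace ℝ (Fin 3)) K, ‖Literature.Analysis.FluidPDE.curl (v n) x‖ ^ 2) →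
      ∀ (φ₀ : ℕ → ℕ) (M : Fin 3 → EuclideanSpace ℝ (Fin 3) → EuclideanSpace ℝ (Fin 3)), StrictMono φ₀ →
      (∀ j, MemLp (M j) 2 volume) →
      (∀ (j : Fin 3) (ψ : EuclideanSpace ℝ (Fin 3) → EuclideanSpace ℝ (Fin 3)), MemLp ψ 2 volume →
        Tendsto (fun k => ∫ x, ⟪fderiv ℝ (v (φ₀ k)) x (EuclideanSpace.basisFun (Fin 3) ℝ j), ψ x⟫_ℝ) atTop
          (𝓝 (∫ x, ⟪M j x, ψ x⟫_ℝ))) →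
      ∃ w : EuclideanSpace ℝ (Fin 3) → EuclideanSpace ℝ (Fin 3), (ContDiff ℝ (⊤ : ℕ∞) w ∧
      Literature.Analysis.FluidPDE.VectorCalculus.IsDivFree w ∧ (∫⁻ x, ‖iteratedFDeriv ℝ 0 w x‖ₑ ^ 2 < ⊤) ∧
      (∫⁻ x, ‖iteratedFDeriv ℝ 1 w x‖ₑ ^ 2 < ⊤) ∧ (∫⁻ x, ‖iteratedFDeriv ℝ 2 w x‖ₑ ^ 2 < ⊤)) ∧
        (∀ j : Fin 3, (fun x => fderiv ℝ w x (EuclideanSpace.basisFun (Fin 3) ℝ j)) =ᵐ[volume] M j) ∧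
        ∃ φ₁ : ℕ → ℕ, StrictMono φ₁ ∧
        (∀ R : ℝ, 0 < R → Tendsto (fun k => ∫ x in Metric.ball (0 : EuclideanSpace ℝ (Fin 3)) R,
          ‖Literature.Analysis.FluidPDE.curl (v (φ₀ (φ₁ k)) - w) x‖ ^ 2) atTop (𝓝 0))) :
    Summit.NavierStokesRegularity.NavierStokesRegularity.Theses.EfficiencyFloor.NearSaturationNearMaximiser :=
  nearSaturationNearMaximiser_of_compact fun c hsharp =>
    compact_of_gradientIdentification hsharp.1 (fun f hf => hsharp.2.1 f hf) (HWi c hsharp)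

end SeqCore

end NearSaturationNearMaximiser

end Summit.NavierStokesRegularity.NavierStokesRegularity.Theorems

end
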